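import Mathlib
import HarnessLib
import Summits.AtomisticToContinuum.HydrodynamicLimit.Theses.PesinPricing
import Literature.MathematicalPhysics.KineticTheory.HardSphereTwoTimePressure

/-!
# Crux `UpperVolumeLemma` (stmt-AtomisticToContinuum-9426, route PesinPricing, rank 2) — birth skeleton `Lines/birth.lean`

BC3 skeleton (registrar seat planner-skel-stmt-AtomisticToContinuum-9426-0, 2026-08-17): the crux
`Summit.AtomisticToContinuum.HydrodynamicLimit.Theses.PesinPricing.UpperVolumeLemma` (the N-UNIFORM
UPPER VOLUME LEMMA: under the invariant homogeneous Gibbs law `G_N` the configuration tube of radius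
`ε/16` around a.e. orbit on `[t₁,t₂]` has measure `≤ exp(C(N+1) + C·K − Λ) ·` (reference ball at `t₁`),
`Λ = Σ_{non-grazing collisions} log(1 + |g|τ⁺/ε)`, `C` independent of `N`) is cut along the route's own
two-layer plan `UpperVolumeLemma ⇐ TwoBodyTube → TubeFactorisation` (route header, TWO-LAYER PLAN),
with the kinematic reduction "configuration tube ⊆ phase-space tube" made a separate, provable-now stub:

* `stub_twoBodyTube` (TWO-BODY ONE-POWER TUBE ESTIMATE, scale-free; the route's CHEAPEST FALSIFIER (i)):
  for two hard spheres of ANY diameter `ε > 0` in `ℝ³` (Euclidean geometry, Liouville measure, at most one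
  collision ever), for Liouville-a.e. initial datum `z` and every window `t₁ < t₂`, the configuration
  tube of radius `ε/16` around the orbit of `z` has Liouville measure
  `≤ exp(C₂ − Λ₂) ·` (reference ball at `t₁`: positions within `ε/16`, velocities within
  `ε/(8·(first collision time after t₁, capped at t₂, minus t₁))`), where `Λ₂ = log(1 + |g|(t₂ − τ)/ε)` if
  the collision at `τ ∈ [t₁,t₂]` is non-grazing (`ε|g| ≤ 2|⟨x₀ − x₁, g⟩|`) and `0` otherwise; `C₂` ABSOLUTE
  (dispersing reflection off a sphere of radius `ε`: the outgoing direction moves by `≍ 2δb/(ε cos φ)` with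
  the impact offset `δb`, so shadowing over the outgoing flight `τ⁺` confines `δb` to
  `≍ ε·(1 + |g|τ⁺/ε)⁻¹` per transverse direction — two directions in `d = 3`, ONE charged; a.e. in `z`
  because an orbit colliding exactly at `t₁` has the tight post-collisional reference ball and no room
  for the charge — a Liouville-null event). Size M (explicit two-body scattering + change of variables).
* `stub_shadowVelocity` (KINEMATIC CONFINEMENT, deterministic, provable now): for good data `z, z'` of the
  `N+1`-sphere flow on `𝕋³` (`σ < 1`, so `ε/16 < 1/16` and an `ε/16`-ball of the torus lifts isometrically),
  if `z'` shadows `z` in CONFIGURATION within `ε/16` on `[t₁,t₂]` then for every `s ∈ [t₁,t₂]` and every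
  particle `i`, `‖v'_i(s) − v_i(s)‖ · (τ_i(s) − s) ≤ ε/8`, `τ_i(s)` = the next time after `s` at which
  particle `i` collides in EITHER orbit (capped at `t₂`): on `[s, τ_i(s))` both copies of `i` fly freely
  (velocities change only at collisions involving `i`, `collidePair_apply_of_ne`; positions continuous),
  and a straight path staying in an `ε/16`-ball of `𝕋³` has length `≤ ε/8`. Size M (piecewise
  free-flight bookkeeping over the locally finite collision times + torus lifting).
* `stub_tubeFactorisation` (N-UNIFORM INHERITANCE — the heart, TubeFactorisation of the two-layer plan;
  hardest stub, size L): ANY two-body tube charge `q` (a function of `x = |g|τ⁺/ε`) certified by the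
  two-body estimate with constant `C₂` is inherited by the gas, uniformly in `N`: under `G_N`, for a.e.
  orbit, the PHASE-SPACE tube (configuration within `ε/16` on `[t₁,t₂]` AND velocities within the
  kinematic tolerance of `stub_shadowVelocity`) has measure `≤ exp(C(N+1) + C·K − Σ_{non-grazing c} q(x_c))
  ·` (reference ball), `C = C(σ, θe, C₂, q)` independent of `N`, for `σ < σ₀` (dilute statics: the
  conditional law of one sphere given the others is uniform on a region of volume `≥ 1 − (4π/3)σ³` times an
  independent Maxwellian). This is where the crux's `why it might fail` lives (O(1) distortion PER
  COLLISION uniformly in `N`; BalintEtAl2002: no N-uniform growth lemma even for discs).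
* `UpperVolumeLemma_of` (the glue, proved here, no `sorry`; hypotheses = the three stubs BY NAME through the
  `__Registered.stub_…` aliases of §1b, as the native skeleton audit requires): instantiate the inheritance at
  `q = log(1 + ·)` with the two-body constant, shrink `σ₀` below `1`, and pass from the configuration tube
  to the phase-space tube inside the measure using `stub_shadowVelocity` on the `G_N`-conull good set
  (`ae_mem_good_localGibbsLaw`, `measure_mono_ae`); `UpperVolumeLemma_proof : UpperVolumeLemma` (no hypotheses)
  is the registered target — the crux modulo exactly the three sorried stubs.
Layout: §1 statements as named `Prop`s · §1b `__Registered` aliases · §2 the sorried stubs (signatures verbatim,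
`sorry` ONLY there) + definitional-agreement `example`s · §3 composition (sorry-free).

Disproof used: none — the crux has no `Disproof.lean` / `Negative/` lemmas on file (`ledger crux ls
stmt-AtomisticToContinuum-9426`: no workfiles, 2026-08-17); negatives index of the summit checked.
Leans on (by name): `Literature.Analysis.FluidPDE.HardSphereFlow` (+ `.good`, `.flow`),
`Literature.Analysis.FluidPDE.{liouville, contactSet, collisionTimes, numCollisions, Config}`,
`Literature.Analysis.FluidPDE.Torus.{geometry, euclidDist}`, `Literature.Analysis.FluidPDE.Euclidean.geometry`,
`Literature.MathematicalPhysics.KineticTheory.{hsDiameter, localGibbsLaw, ae_mem_good_localGibbsLaw}`,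
Mathlib `MeasureTheory.measure_mono_ae`.
-/

namespace Summit.AtomisticToContinuum.HydrodynamicLimit.Cruxes.UpperVolumeLemma.Birth

open scoped BigOperators Topology Manifold Classical MeasureTheory ProbabilityTheory Matrix InnerProductSpace ComplexConjugate ContinuousMap
open Filter Set Function TopologicalSpace MeasureTheory

/-! ## §1 The three stub STATEMENTS as named `Prop`s (verbatim the signatures of the sorried stubs of §2) -/

/-- Statement of stub 1 — TWO-BODY ONE-POWER TUBE ESTIMATE (scale-free, Euclidean, Liouville; the route's cheapest
falsifier (i) made formal): ∃ absolute `C₂` such that for every diameter `ε > 0`, every two-sphere flow `Ψ`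
in `ℝ³`, every window `t₁ < t₂` and Liouville-a.e. `z`, the `ε/16`-configuration tube around the orbit of
`z` has measure `≤ exp(C₂ − Λ₂)` times the reference ball at `t₁`, `Λ₂ = log(1 + |g|(t₂ − τ)/ε)` for a
non-grazing collision at `τ ∈ [t₁,t₂]` (two balls in `ℝ³` collide at most once, so `τ⁺ = t₂ − τ`), else `0`.
Why plausible: dispersing reflection confines the impact offset to `≍ ε(1+|g|τ⁺/ε)⁻¹` per transverse
direction (two available, one charged); first/last-flight and pre/post-collisional ambiguities at `t₁`
cost `O(1)`. Size M. [Young1990 Thm 1 (volume lemma); ChernovDolgopyat2009; BalintEtAl2002] -/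
def TwoBodyTube : Prop :=
  ∃ C₂ : ℝ, ∀ ε : ℝ, 0 < ε → ∀ (Ψ : Literature.Analysis.FluidPDE.HardSphereFlow (Literature.Analysis.FluidPDE.Euclidean.geometry (Fin 3)) ε 2) (t₁ t₂ : ℝ), t₁ < t₂ → ∀ᵐ z ∂(Literature.Analysis.FluidPDE.liouville (Literature.Analysis.FluidPDE.Euclidean.geometry (Fin 3)) 2 ε), (let G := Literature.Analysis.FluidPDE.Euclidean.geometry (Fin 3); let μ := Literature.Analysis.FluidPDE.liouville G 2 ε; let γ : ℝ → Literature.Analysis.FluidPDE.Config 2 (Fin 3) (EuclideanSpace ℝ (Fin 3)) := fun s => Ψ.flow s z; let firstColl : ℝ := sInf ({s : ℝ | t₁ < s ∧ γ s ∈ Literature.Analysis.FluidPDE.contactSet G 2 ε 0 1} ∪ {t₂}); let Λ : ℝ := ∑ᶠ τ ∈ Literature.Analysis.FluidPDE.collisionTimes G ε γ ∩ Set.Icc t₁ t₂, (if ε * ‖(γ τ 0).2 - (γ τ 1).2‖ ≤ 2 * |inner ℝ (G.sepVec (γ τ 0).1 (γ τ 1).1) ((γ τ 0).2 - (γ τ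 1).2)| then Real.log (1 + ‖(γ τ 0).2 - (γ τ 1).2‖ * (t₂ - τ) / ε) else 0); μ {z' | ∀ s ∈ Set.Icc t₁ t₂, ∀ i : Fin 2, ‖(Ψ.flow s z' i).1 - (γ s i).1‖ ≤ ε / 16} ≤ ENNReal.ofReal (Real.exp (C₂ - Λ)) * μ {z' | ∀ i : Fin 2, ‖(Ψ.flow t₁ z' i).1 - (γ t₁ i).1‖ ≤ ε / 16 ∧ ‖(Ψ.flow t₁ z' i).2 - (γ t₁ i).2‖ ≤ ε / (8 * (firstColl - t₁))})

/-- Statement of stub 2 — KINEMATIC CONFINEMENT (configuration shadowing forces velocity shadowing on common free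
flights; deterministic, provable now): for `0 < σ < 1`, good `z, z'`, if every particle of `Φ_s z'` stays
within torus distance `ε/16` of the same particle of `Φ_s z` for all `s ∈ [t₁,t₂]`, then for all
`s ∈ [t₁,t₂]` and `i`, `‖v'_i(s) − v_i(s)‖ · (τ_i(s) − s) ≤ ε/8`, where `τ_i(s)` is the first time after
`s` at which particle `i` is in contact in either orbit, capped at `t₂` (product form: no division,
trivial when `τ_i(s) = s`). Size M. [GST2013 §4.1 (hard-sphere trajectories); folklore] -/
def ShadowVelocity : Prop :=
  ∀ σ : ℝ, 0 < σ → σ < 1 → ∀ (N : ℕ) (Φ : Literature.Analysis.FluidPDE.HardSphereFlow (Literature.Analysis.FluidPDE.Torus.geometry (Fin 3)) (Literature.MathematicalPhysics.KineticTheory.hsDiameter σ N) (N + 1)) (t₁ t₂ : ℝ), t₁ < t₂ → ∀ z ∈ Φ.good, ∀ z' ∈ Φ.good, (let ε : ℝ := Literature.MathematicalPhysics.KineticTheory.hsDiameter σ N; let G := Literature.Analysis.FluidPDE.Torus.geometry (Fin 3); let γ : ℝ → Literature.Analysis.FluidPDE.Config (N + 1) (Fin 3) Literature.MathematicalPhysics.KineticTheory.T3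 := fun s => Φ.flow s z; let nextFree : ℝ → Fin (N + 1) → ℝ := fun s i => sInf ({r : ℝ | s < r ∧ ∃ l : Fin (N + 1), i ≠ l ∧ (γ r ∈ Literature.Analysis.FluidPDE.contactSet G (N + 1) ε i l ∨ Φ.flow r z' ∈ Literature.Analysis.FluidPDE.contactSet G (N + 1) ε i l)} ∪ {t₂}); (∀ s ∈ Set.Icc t₁ t₂, ∀ i : Fin (N + 1), Literature.Analysis.FluidPDE.Torus.euclidDist (Φ.flow s z' i).1 (γ s i).1 ≤ ε / 16) → ∀ s ∈ Set.Icc t₁ t₂, ∀ i : Fin (N + 1), ‖(Φ.flow s z' i).2 - (γ s i).2‖ * (nextFree s i - s) ≤ ε / 8)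

/-- Statement of stub 3 — N-UNIFORM TUBE FACTORISATION / INHERITANCE (the heart of the crux; TubeFactorisation of
the route's two-layer plan): every two-body tube charge `q` certified by the two-body estimate with constant
`C₂` (the antecedent is VERBATIM `TwoBodyTube`'s body with `log(1+·)` replaced by `q`) is inherited by the
`N+1`-sphere gas under the invariant homogeneous Gibbs law `G_N`, uniformly in `N`: ∃ σ₀ ∀ σ < σ₀ ∀ θe ∃ C
∀ N Φ t₁<t₂, for `G_N`-a.e. orbit the PHASE-SPACE tube (configuration within `ε/16` on `[t₁,t₂]` AND
velocities within the kinematic tolerance of stub 2) has measure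
`≤ exp(C(N+1) + C·K − Σ_{non-grazing collisions} q(|g|τ⁺/ε))` times the reference ball of the crux (all other
`let`s verbatim the crux's). Why it might fail = the crux's: O(1) distortion per collision uniformly in `N`
(earlier grazing / near-simultaneous collisions may focus the conditional law of later impact offsets); no
N-uniform growth lemma is known even for `N` discs (BalintEtAl2002). Size L (hardest stub).
[Young1990; BowenRuelle1975; SinaiChernov1987; BalintEtAl2002; VanzonVanbeijerenDellago1998] -/
def TubeFactorisation : Prop :=
  ∀ (q : ℝ → ℝ) (C₂ : ℝ), (∀ ε : ℝ, 0 < ε → ∀ (Ψ : Literature.Analysis.FluidPDE.HardSphereFlow (Literature.Analysis.FluidPDE.Euclidean.geometry (Fin 3)) ε 2) (t₁ t₂ : ℝ), t₁ < t₂ → ∀ᵐ z ∂(Literature.Analysis.FluidPDE.liouville (Literature.Analysis.FluidPDE.Euclidean.geometry (Fin 3)) 2 ε), (let G := Literature.Analysis.FluidPDE.Euclidean.geometry (Fin 3); let μ := Literature.Analysis.FluidPDE.liouville G 2 ε; let γ : ℝ → Literature.Analysis.FluidPDE.Config 2 (Fin 3) (EuclideanSpace ℝ (Fin 3)) := fun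 s => Ψ.flow s z; let firstColl : ℝ := sInf ({s : ℝ | t₁ < s ∧ γ s ∈ Literature.Analysis.FluidPDE.contactSet G 2 ε 0 1} ∪ {t₂}); let Λ : ℝ := ∑ᶠ τ ∈ Literature.Analysis.FluidPDE.collisionTimes G ε γ ∩ Set.Icc t₁ t₂, (if ε * ‖(γ τ 0).2 - (γ τ 1).2‖ ≤ 2 * |inner ℝ (G.sepVec (γ τ 0).1 (γ τ 1).1) ((γ τ 0).2 - (γ τ 1).2)| then q (‖(γ τ 0).2 - (γ τ 1).2‖ * (t₂ - τ) / ε) else 0); μ {z' | ∀ s ∈ Set.Icc t₁ t₂, ∀ i : Fin 2, ‖(Ψ.flow s z' i).1 - (γ s i).1‖ ≤ ε / 16} ≤ ENNReal.ofReal (Real.exp (C₂ - Λ)) * μ {z' | ∀ i : Fin 2, ‖(Ψ.flow t₁ z' i).1 - (γ t₁ i).1‖ ≤ ε / 16 ∧ ‖(Ψ.flow t₁ z' i).2 - (γ t₁ i).2‖ ≤ ε / (8 * (firstColl - t₁))})) → ∃ σ₀ : ℝ, 0 < σ₀ ∧ ∀ σ : ℝ, 0 < σ → σ < σ₀ → ∀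 θe : ℝ, 0 < θe → ∃ C : ℝ, ∀ (N : ℕ) (Φ : Literature.Analysis.FluidPDE.HardSphereFlow (Literature.Analysis.FluidPDE.Torus.geometry (Fin 3)) (Literature.MathematicalPhysics.KineticTheory.hsDiameter σ N) (N + 1)) (t₁ t₂ : ℝ), t₁ < t₂ → ∀ᵐ z ∂(Literature.MathematicalPhysics.KineticTheory.localGibbsLaw σ (fun _ => 1) (fun _ => 0) (fun _ => θe) N Φ), (let ε : ℝ := Literature.MathematicalPhysics.KineticTheory.hsDiameter σ N; let G := Literature.Analysis.FluidPDE.Torus.geometry (Fin 3); let μ := Literature.MathematicalPhysics.KineticTheory.localGibbsLaw σ (fun _ => 1) (fun _ => 0) (fun _ => θe) N Φ; let γ : ℝ → Literature.Analysis.FluidPDE.Config (N + 1) (Fin 3) Literature.MathematicalPhysics.KineticTheory.T3 := fun s => Φ.flow s z; let nextColl : ℝ → Fin (N + 1) → Fin (N + 1) → ℝ := fun τ i j => sInf ({s : ℝ | τ < s ∧ ∃ k l : Fin (N + 1), k ≠ l ∧ (k = i ∨ k = j) ∧ γ s ∈ Literature.Analysis.FluidPDE.contactSet G (N + 1) ε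 k l} ∪ {t₂}); let firstColl : Fin (N + 1) → ℝ := fun i => sInf ({s : ℝ | t₁ < s ∧ ∃ l : Fin (N + 1), i ≠ l ∧ γ s ∈ Literature.Analysis.FluidPDE.contactSet G (N + 1) ε i l} ∪ {t₂}); let Λ : ℝ := ∑ᶠ τ ∈ Literature.Analysis.FluidPDE.collisionTimes G ε γ ∩ Set.Icc t₁ t₂, ∑ i : Fin (N + 1), ∑ j : Fin (N + 1), (if i < j ∧ γ τ ∈ Literature.Analysis.FluidPDE.contactSet G (N + 1) ε i j ∧ ε * ‖(γ τ i).2 - (γ τ j).2‖ ≤ 2 * |inner ℝ (G.sepVec (γ τ i).1 (γ τ j).1) ((γ τ i).2 - (γ τ j).2)| then q (‖(γ τ i).2 - (γ τ j).2‖ * (nextColl τ i j - τ) / ε) else 0); let K : ℝ := (Literature.Analysis.FluidPDE.numCollisions G ε γ t₁ t₂ : ℝ); let nextFree : Literature.Analysis.FluidPDE.Config (N + 1) (Fin 3) Literature.MathematicalPhysics.KineticTheory.T3 → ℝ → Fin (N + 1) → ℝ := fun z' s i => sInf ({r : ℝ | s < r ∧ ∃ l : Fin (N + 1), i ≠ l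 ∧ (γ r ∈ Literature.Analysis.FluidPDE.contactSet G (N + 1) ε i l ∨ Φ.flow r z' ∈ Literature.Analysis.FluidPDE.contactSet G (N + 1) ε i l)} ∪ {t₂}); μ {z' | (∀ s ∈ Set.Icc t₁ t₂, ∀ i : Fin (N + 1), Literature.Analysis.FluidPDE.Torus.euclidDist (Φ.flow s z' i).1 (γ s i).1 ≤ ε / 16) ∧ (∀ s ∈ Set.Icc t₁ t₂, ∀ i : Fin (N + 1), ‖(Φ.flow s z' i).2 - (γ s i).2‖ * (nextFree z' s i - s) ≤ ε / 8)} ≤ ENNReal.ofReal (Real.exp (C * (N + 1) + C * K - Λ)) * μ {z' | ∀ i : Fin (N + 1), Literature.Analysis.FluidPDE.Torus.euclidDist (Φ.flow t₁ z' i).1 (γ t₁ i).1 ≤ ε / 16 ∧ ‖(Φ.flow t₁ z' i).2 - (γ t₁ i).2‖ ≤ ε / (8 * (firstColl i - t₁))})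

/-! ## §1b The statements BY STUB NAME — admissible hypotheses of `UpperVolumeLemma_of`

`#h21_check_skeleton` (run by `ledger skeleton check`) admits a hypothesis of the composing theorem only if its head
constant is a registered obligation or is NAMED like a declared stub (last name component), and `@[stub]` is
gate-reserved; so each statement is mirrored by `abbrev __Registered.stub_X : Prop := X` (device of the sibling birth
skeletons `FastCollisionThroughput/Lines/birth.lean`, `ChaosClosure/Lines/birth.lean`; the `__` namespace is an
implementation detail the audit skips, so each `stub_…` resolves to the sorried theorem of §2). -/
namespace __Registered

/-- Alias of `TwoBodyTube`, keyed by the registered name `stub_twoBodyTube`. -/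
abbrev stub_twoBodyTube : Prop := TwoBodyTube

/-- Alias of `ShadowVelocity`, keyed by the registered name `stub_shadowVelocity`. -/
abbrev stub_shadowVelocity : Prop := ShadowVelocity

/-- Alias of `TubeFactorisation`, keyed by the registered name `stub_tubeFactorisation`. -/
abbrev stub_tubeFactorisation : Prop := TubeFactorisation

end __Registered

/-! ## §2 The registered stubs (the open obligations; `sorry` lives ONLY here; signatures = the statements verbatim) -/

/-- STUB 1 (two-body one-power tube estimate; size M): body VERBATIM `TwoBodyTube`. -/
theorem stub_twoBodyTube : ∃ C₂ : ℝ, ∀ ε : ℝ, 0 < ε → ∀ (Ψ : Literature.Analysis.FluidPDE.HardSphereFlow (Literature.Analysis.FluidPDE.Euclidean.geometry (Fin 3)) ε 2) (t₁ t₂ : ℝ), t₁ < t₂ → ∀ᵐ z ∂(Literature.Analysis.FluidPDE.liouville (Literature.Analysis.FluidPDE.Euclidean.geometry (Fin 3)) 2 ε), (let G := Literature.Analysis.FluidPDE.Euclidean.geometry (Fin 3); let μ := Literature.Analysis.FluidPDE.liouville G 2 ε; let γ : ℝ → Literature.Analysis.FluidPDE.Config 2 (Fin 3) (EuclideanSpace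 ℝ (Fin 3)) := fun s => Ψ.flow s z; let firstColl : ℝ := sInf ({s : ℝ | t₁ < s ∧ γ s ∈ Literature.Analysis.FluidPDE.contactSet G 2 ε 0 1} ∪ {t₂}); let Λ : ℝ := ∑ᶠ τ ∈ Literature.Analysis.FluidPDE.collisionTimes G ε γ ∩ Set.Icc t₁ t₂, (if ε * ‖(γ τ 0).2 - (γ τ 1).2‖ ≤ 2 * |inner ℝ (G.sepVec (γ τ 0).1 (γ τ 1).1) ((γ τ 0).2 - (γ τ 1).2)| then Real.log (1 + ‖(γ τ 0).2 - (γ τ 1).2‖ * (t₂ - τ) / ε) else 0); μ {z' | ∀ s ∈ Set.Icc t₁ t₂, ∀ i : Fin 2, ‖(Ψ.flow s z' i).1 - (γ s i).1‖ ≤ ε / 16} ≤ ENNReal.ofReal (Real.exp (C₂ - Λ)) * μ {z' | ∀ i : Fin 2, ‖(Ψ.flow t₁ z' i).1 - (γ t₁ i).1‖ ≤ ε / 16 ∧ ‖(Ψ.flow t₁ z' i).2 - (γ t₁ i).2‖ ≤ ε / (8 * (firstColl - t₁))}) := by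
  sorry

/-- STUB 2 (kinematic confinement; size M, provable now): body VERBATIM `ShadowVelocity`. -/
theorem stub_shadowVelocity : ∀ σ : ℝ, 0 < σ → σ < 1 → ∀ (N : ℕ) (Φ : Literature.Analysis.FluidPDE.HardSphereFlow (Literature.Analysis.FluidPDE.Torus.geometry (Fin 3)) (Literature.MathematicalPhysics.KineticTheory.hsDiameter σ N) (N + 1)) (t₁ t₂ : ℝ), t₁ < t₂ → ∀ z ∈ Φ.good, ∀ z' ∈ Φ.good, (let ε : ℝ := Literature.MathematicalPhysics.KineticTheory.hsDiameter σ N; let G := Literature.Analysis.FluidPDE.Torus.geometry (Fin 3); let γ : ℝ → Literature.Analysis.FluidPDE.Config (N + 1) (Fin 3) Literature.MathematicalPhysics.KineticTheory.T3 := fun s => Φ.flow s z; let nextFree : ℝ → Fin (N + 1) → ℝ := fun s i => sInf ({r : ℝ | s < r ∧ ∃ l : Fin (N + 1), i ≠ l ∧ (γ r ∈ Literature.Analysis.FluidPDE.contactSet G (N + 1) ε i l ∨ Φ.flow r z' ∈ Literature.Analysis.FluidPDE.contactSet G (N + 1) ε i l)} ∪ {t₂}); (∀ s ∈ Set.Icc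 t₁ t₂, ∀ i : Fin (N + 1), Literature.Analysis.FluidPDE.Torus.euclidDist (Φ.flow s z' i).1 (γ s i).1 ≤ ε / 16) → ∀ s ∈ Set.Icc t₁ t₂, ∀ i : Fin (N + 1), ‖(Φ.flow s z' i).2 - (γ s i).2‖ * (nextFree s i - s) ≤ ε / 8) := by
  sorry

/-- STUB 3 (N-uniform inheritance; size L, THE HARDEST): body VERBATIM `TubeFactorisation`. -/
theorem stub_tubeFactorisation : ∀ (q : ℝ → ℝ) (C₂ : ℝ), (∀ ε : ℝ, 0 < ε → ∀ (Ψ : Literature.Analysis.FluidPDE.HardSphereFlow (Literature.Analysis.FluidPDE.Euclidean.geometry (Fin 3)) ε 2) (t₁ t₂ : ℝ), t₁ < t₂ → ∀ᵐ z ∂(Literature.Analysis.FluidPDE.liouville (Literature.Analysis.FluidPDE.Euclidean.geometry (Fin 3)) 2 ε), (let G := Literature.Analysis.FluidPDE.Euclidean.geometry (Fin 3); let μ := Literature.Analysis.FluidPDE.liouville G 2 ε; let γ : ℝ → Literature.Analysis.FluidPDE.Config 2 (Fin 3) (EuclideanSpace ℝ (Fin 3)) := fun s => Ψ.flow s z;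 let firstColl : ℝ := sInf ({s : ℝ | t₁ < s ∧ γ s ∈ Literature.Analysis.FluidPDE.contactSet G 2 ε 0 1} ∪ {t₂}); let Λ : ℝ := ∑ᶠ τ ∈ Literature.Analysis.FluidPDE.collisionTimes G ε γ ∩ Set.Icc t₁ t₂, (if ε * ‖(γ τ 0).2 - (γ τ 1).2‖ ≤ 2 * |inner ℝ (G.sepVec (γ τ 0).1 (γ τ 1).1) ((γ τ 0).2 - (γ τ 1).2)| then q (‖(γ τ 0).2 - (γ τ 1).2‖ * (t₂ - τ) / ε) else 0); μ {z' | ∀ s ∈ Set.Icc t₁ t₂, ∀ i : Fin 2, ‖(Ψ.flow s z' i).1 - (γ s i).1‖ ≤ ε / 16} ≤ ENNReal.ofReal (Real.exp (C₂ - Λ)) * μ {z' | ∀ i : Fin 2, ‖(Ψ.flow t₁ z' i).1 - (γ t₁ i).1‖ ≤ ε / 16 ∧ ‖(Ψ.flow t₁ z' i).2 - (γ t₁ i).2‖ ≤ ε / (8 * (firstColl - t₁))})) → ∃ σ₀ : ℝ, 0 < σ₀ ∧ ∀ σ : ℝ, 0 < σ → σ < σ₀ → ∀ θe : ℝ, 0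 < θe → ∃ C : ℝ, ∀ (N : ℕ) (Φ : Literature.Analysis.FluidPDE.HardSphereFlow (Literature.Analysis.FluidPDE.Torus.geometry (Fin 3)) (Literature.MathematicalPhysics.KineticTheory.hsDiameter σ N) (N + 1)) (t₁ t₂ : ℝ), t₁ < t₂ → ∀ᵐ z ∂(Literature.MathematicalPhysics.KineticTheory.localGibbsLaw σ (fun _ => 1) (fun _ => 0) (fun _ => θe) N Φ), (let ε : ℝ := Literature.MathematicalPhysics.KineticTheory.hsDiameter σ N; let G := Literature.Analysis.FluidPDE.Torus.geometry (Fin 3); let μ := Literature.MathematicalPhysics.KineticTheory.localGibbsLaw σ (fun _ => 1) (fun _ => 0) (fun _ => θe) N Φ; let γ : ℝ → Literature.Analysis.FluidPDE.Config (N + 1) (Fin 3) Literature.MathematicalPhysics.KineticTheory.T3 := fun s => Φ.flow s z; let nextColl : ℝ → Fin (N + 1) → Fin (N + 1) → ℝ := fun τ i j => sInf ({s : ℝ | τ < s ∧ ∃ k l : Fin (N + 1), k ≠ l ∧ (k = i ∨ k = j) ∧ γ s ∈ Literature.Analysis.FluidPDE.contactSet G (N + 1) ε k l} ∪ {t₂});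 let firstColl : Fin (N + 1) → ℝ := fun i => sInf ({s : ℝ | t₁ < s ∧ ∃ l : Fin (N + 1), i ≠ l ∧ γ s ∈ Literature.Analysis.FluidPDE.contactSet G (N + 1) ε i l} ∪ {t₂}); let Λ : ℝ := ∑ᶠ τ ∈ Literature.Analysis.FluidPDE.collisionTimes G ε γ ∩ Set.Icc t₁ t₂, ∑ i : Fin (N + 1), ∑ j : Fin (N + 1), (if i < j ∧ γ τ ∈ Literature.Analysis.FluidPDE.contactSet G (N + 1) ε i j ∧ ε * ‖(γ τ i).2 - (γ τ j).2‖ ≤ 2 * |inner ℝ (G.sepVec (γ τ i).1 (γ τ j).1) ((γ τ i).2 - (γ τ j).2)| then q (‖(γ τ i).2 - (γ τ j).2‖ * (nextColl τ i j - τ) / ε) else 0); let K : ℝ := (Literature.Analysis.FluidPDE.numCollisions G ε γ t₁ t₂ : ℝ); let nextFree : Literature.Analysis.FluidPDE.Config (N + 1) (Fin 3) Literature.MathematicalPhysics.KineticTheory.T3 → ℝ → Fin (N + 1) → ℝ := fun z' s i => sInf ({r : ℝ | s < r ∧ ∃ l : Fin (N + 1), i ≠ l ∧ (γ r ∈ Literature.Analysis.FluidPDE.contactSet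 G (N + 1) ε i l ∨ Φ.flow r z' ∈ Literature.Analysis.FluidPDE.contactSet G (N + 1) ε i l)} ∪ {t₂}); μ {z' | (∀ s ∈ Set.Icc t₁ t₂, ∀ i : Fin (N + 1), Literature.Analysis.FluidPDE.Torus.euclidDist (Φ.flow s z' i).1 (γ s i).1 ≤ ε / 16) ∧ (∀ s ∈ Set.Icc t₁ t₂, ∀ i : Fin (N + 1), ‖(Φ.flow s z' i).2 - (γ s i).2‖ * (nextFree z' s i - s) ≤ ε / 8)} ≤ ENNReal.ofReal (Real.exp (C * (N + 1) + C * K - Λ)) * μ {z' | ∀ i : Fin (N + 1), Literature.Analysis.FluidPDE.Torus.euclidDist (Φ.flow t₁ z' i).1 (γ t₁ i).1 ≤ ε / 16 ∧ ‖(Φ.flow t₁ z' i).2 - (γ t₁ i).2‖ ≤ ε / (8 * (firstColl i - t₁))}) := by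
  sorry

/-- The registered theorems, the `__Registered` aliases and the named `Prop`s are the same statements. -/
example : __Registered.stub_twoBodyTube := stub_twoBodyTube
example : __Registered.stub_shadowVelocity := stub_shadowVelocity
example : __Registered.stub_tubeFactorisation := stub_tubeFactorisation
example : TwoBodyTube = __Registered.stub_twoBodyTube := rfl
example : ShadowVelocity = __Registered.stub_shadowVelocity := rfl
example : TubeFactorisation = __Registered.stub_tubeFactorisation := rfl

/-! ## §3 Composition (kernel-checked; no `sorry` below this line) -/

/-- **THE GLUE / SKELETON THEOREM** `stub₁ → stub₂ → stub₃ → UpperVolumeLemma` (the crux BY NAME; hypotheses = the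
three registered stubs by name via their `__Registered` aliases; no `sorry`): instantiate the inheritance (stub 3) at the
dilute-gas clock charge `q = log(1 + ·)` with the two-body constant of stub 1, shrink `σ₀` below `1`, and replace the
phase-space tube by the configuration tube of the crux inside the measure: `G_N`-a.e. datum is good
(`ae_mem_good_localGibbsLaw`) and good configuration-shadowing data satisfy the kinematic tolerance (stub 2), so the
configuration tube is a.e.-contained in the phase-space tube (`measure_mono_ae`). -/
theorem UpperVolumeLemma_of :
    __Registered.stub_twoBodyTube → __Registered.stub_shadowVelocity → __Registered.stub_tubeFactorisation →
      Summit.AtomisticToContinuum.HydrodynamicLimit.Theses.PesinPricing.UpperVolumeLemma := by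
  intro h1 h2 h3
  obtain ⟨C₂, hC₂⟩ := h1
  obtain ⟨σ₀, hσ₀, H⟩ := h3 (fun x => Real.log (1 + x)) C₂ hC₂
  refine ⟨min σ₀ 1, lt_min hσ₀ one_pos, ?_⟩
  intro σ hσ hσlt θe hθe
  have hσ₀' : σ < σ₀ := lt_of_lt_of_le hσlt (min_le_left _ _)
  have hσ1 : σ < 1 := lt_of_lt_of_le hσlt (min_le_right _ _)
  obtain ⟨C, HC⟩ := H σ hσ hσ₀' θe hθe
  refine ⟨C, ?_⟩
  intro N Φ t₁ t₂ ht
  have hgood := Literature.MathematicalPhysics.KineticTheory.ae_mem_good_localGibbsLaw σ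
    (fun _ => 1) (fun _ => 0) (fun _ => θe) N Φ
  filter_upwards [HC N Φ t₁ t₂ ht, hgood] with z hz hzg
  dsimp only at hz ⊢
  refine le_trans ?_ hz
  refine measure_mono_ae ?_
  have h2' := h2 σ hσ hσ1 N Φ t₁ t₂ ht z hzg
  dsimp only at h2'
  filter_upwards [hgood] with z' hg
  intro hz'T
  exact And.intro hz'T (h2' z' hg hz'T)

/-- **The line's closing theorem, modulo the three registered stubs** (the crux BY NAME with no hypotheses; it
depends on `sorryAx` exactly through `stub_twoBodyTube`, `stub_shadowVelocity`, `stub_tubeFactorisation` and becomes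
the crux proof when they land). -/
theorem UpperVolumeLemma_proof : Summit.AtomisticToContinuum.HydrodynamicLimit.Theses.PesinPricing.UpperVolumeLemma :=
  UpperVolumeLemma_of stub_twoBodyTube stub_shadowVelocity stub_tubeFactorisation

end Summit.AtomisticToContinuum.HydrodynamicLimit.Cruxes.UpperVolumeLemma.Birth
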